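import Summits.AtomisticToContinuum.Crystallization.Theorems.FrustratedLawDichotomyAveragingRuleCertFormat

/-!
# FrustratedLawDichotomy · the certificate-format feed at lens-5's dial radii `ρ ∈ {3/2, 21/10, 13/5}` (two and three shells)

`…AveragingRuleCertFormat` (hand-2 g13) lands the one-shell literal (`ρ = 23/20`).  Critic row 518 (4) asks census TAG 181-S(iii)-AVG to report
`ρ*(config) ∈ {1.15, 1.5, 2.1, 2.6}`; if the one-shell family fails on an embedded core, the feed moves to the next radius.  This DEF-FREE file
records the literal nodes at the other three dial radii with `D = 23/10` (cap invisible on every ball with two sites within `23/20` of each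
other, `…Dense`) and locality radius `ρ₁ = 9/2` (`13/10·D + 1 = 3.99 ≤ 9/2`), motif radius `ϱ = ρ + 9/2 ∈ {6, 33/5, 71/10}`, motif sizes
`M ≤ (20ϱ/7 + 1)³` (`< 5972`, `< 7830`, `< 9645`): `aperiodicFrustratedLawGap_fourHalf_of_cert_{threeHalves,twoShells,threeShells}`.

[folklore] chaining; 0 sorry; DEF-FREE.  Prover hand 2, gen 13 (decomp-a2c), `--supports stmt-AtomisticToContinuum-27623`.
-/

noncomputable section

namespace Summit.AtomisticToContinuum.Crystallization.Theorems.FrustratedLawDichotomyAveragingRuleShells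

open scoped BigOperators Classical
open Literature.MathematicalPhysics.StatisticalMechanics (siteEnergy)
open Summit.AtomisticToContinuum.Crystallization.Theorems.ChargedEnergyGapNegative (E3)
open Summit.AtomisticToContinuum.Crystallization.Theorems.FrustratedLawDichotomyRangeCut
open Summit.AtomisticToContinuum.Crystallization.Theorems.FrustratedLawDichotomySchurCut
open Summit.AtomisticToContinuum.Crystallization.Theorems.FrustratedLawDichotomyMotifLemmas
open Summit.AtomisticToContinuum.Crystallization.Theorems.FrustratedLawDichotomyAveragingCut (ball ballAvg)
open Summit.AtomisticToContinuum.Crystallization.Theorems.FrustratedLawDichotomyAveragingRuleCertFormat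

/-- **`ρ = 3/2`** (`ϱ = 6`, motifs `M ≤ (127/7)³ < 5972`). [folklore chaining] -/
theorem aperiodicFrustratedLawGap_fourHalf_of_cert_threeHalves
    (hDoor : Summit.AtomisticToContinuum.Crystallization.Theses.GrainCoreNetworkSplit.MuEquilibriumDoor)
    (hSF : SF₄₅) (hU : PeriodicEnergyCeiling (-(7175 / 10000)))
    (h : ∀ (M : ℕ), (M : ℝ) ≤ (20 * (6 : ℝ) / 7 + 1) ^ 3 → ∀ (z : Fin M → E3), Function.Injective z → Sep z → ∀ c : Fin M,
      (∀ a : Fin M, dist (z a) (z c) ≤ 6) →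
        (∃ j ∈ ball (3 / 2) z c, GoodAtScale (1 / 20) (23 / 10) z j) ∨
          0 ≤ ballAvg (3 / 2) z (fun j => siteEnergy (effPot w₄₅ ω₄ (3 / 400)) z j / 2 - (-(7174 / 10000) + 3 / 400)) c) :
    Summit.AtomisticToContinuum.Crystallization.Theses.FrustratedLawDichotomy.AperiodicFrustratedLawGap :=
  aperiodicFrustratedLawGap_fourHalf_of_cert_bounded (ρ₁ := 9 / 2) hDoor hSF hU (by norm_num) (by norm_num) le_rfl (by norm_num)
    (by norm_num) h

/-- **`ρ = 21/10` (two shells)** (`ϱ = 33/5`, motifs `M ≤ (139/7)³ < 7830`). [folklore chaining] -/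
theorem aperiodicFrustratedLawGap_fourHalf_of_cert_twoShells
    (hDoor : Summit.AtomisticToContinuum.Crystallization.Theses.GrainCoreNetworkSplit.MuEquilibriumDoor)
    (hSF : SF₄₅) (hU : PeriodicEnergyCeiling (-(7175 / 10000)))
    (h : ∀ (M : ℕ), (M : ℝ) ≤ (20 * (33 / 5 : ℝ) / 7 + 1) ^ 3 → ∀ (z : Fin M → E3), Function.Injective z → Sep z → ∀ c : Fin M,
      (∀ a : Fin M, dist (z a) (z c) ≤ 33 / 5) →
        (∃ j ∈ ball (21 / 10) z c, GoodAtScale (1 / 20) (23 / 10) z j) ∨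
          0 ≤ ballAvg (21 / 10) z (fun j => siteEnergy (effPot w₄₅ ω₄ (3 / 400)) z j / 2 - (-(7174 / 10000) + 3 / 400)) c) :
    Summit.AtomisticToContinuum.Crystallization.Theses.FrustratedLawDichotomy.AperiodicFrustratedLawGap :=
  aperiodicFrustratedLawGap_fourHalf_of_cert_bounded (ρ₁ := 9 / 2) hDoor hSF hU (by norm_num) (by norm_num) le_rfl (by norm_num)
    (by norm_num) h

/-- **`ρ = 13/5` (three shells)** (`ϱ = 71/10`, motifs `M ≤ (149/7)³ < 9645`). [folklore chaining] -/
theorem aperiodicFrustratedLawGap_fourHalf_of_cert_threeShells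
    (hDoor : Summit.AtomisticToContinuum.Crystallization.Theses.GrainCoreNetworkSplit.MuEquilibriumDoor)
    (hSF : SF₄₅) (hU : PeriodicEnergyCeiling (-(7175 / 10000)))
    (h : ∀ (M : ℕ), (M : ℝ) ≤ (20 * (71 / 10 : ℝ) / 7 + 1) ^ 3 → ∀ (z : Fin M → E3), Function.Injective z → Sep z → ∀ c : Fin M,
      (∀ a : Fin M, dist (z a) (z c) ≤ 71 / 10) →
        (∃ j ∈ ball (13 / 5) z c, GoodAtScale (1 / 20) (23 / 10) z j) ∨
          0 ≤ ballAvg (13 / 5) z (fun j => siteEnergy (effPot w₄₅ ω₄ (3 / 400)) z j / 2 - (-(7174 / 10000) + 3 / 400)) c) :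
    Summit.AtomisticToContinuum.Crystallization.Theses.FrustratedLawDichotomy.AperiodicFrustratedLawGap :=
  aperiodicFrustratedLawGap_fourHalf_of_cert_bounded (ρ₁ := 9 / 2) hDoor hSF hU (by norm_num) (by norm_num) le_rfl (by norm_num)
    (by norm_num) h

end Summit.AtomisticToContinuum.Crystallization.Theorems.FrustratedLawDichotomyAveragingRuleShells

end
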